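import Summits.AnomalousDissipation.AnomalousDissipation.Theorems.SawtoothPulseCascadeK1LocalisedCascadeKHCombSource
import Summits.AnomalousDissipation.AnomalousDissipation.Theorems.SawtoothPulseCascadeK1LocalisedCascadeKHCombDuhamel
import Summits.AnomalousDissipation.AnomalousDissipation.Theorems.SawtoothPulseCascadeK1LocalisedCascadeKHStableRotation
import Summits.AnomalousDissipation.AnomalousDissipation.Theorems.SawtoothPulseCascadeK1LocalisedCascadeKHStableDetuning

/-!
# K2 lane (route-2 `SawtoothPulseCascade`, crux dir `K1LocalisedCascade`): the COMB-COLUMN creation amplitude — `≤ 0.8863/a` for `a ≥ 4`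

Helper file of the K2 lane (ACL item stmt-AnomalousDissipation-19491; E5 tail of the S4 line, arbiter A26-12/A26-13 «P2-T»). Assembles
`…KHCombDuhamel` (row multiplier, envelope integral) with the Kelvin–Helmholtz block data (`2πG₀ = Σ₀`, `2π conj G_h = S`; any Bloch phase `β`,
`a ≥ 1`): the diagonal block entries `(2πia)(∓¼ ∓ 2G₀)` are PURELY IMAGINARY of modulus `a·p`, `p = π/2 + 2Σ₀ ≥ 0`, the off-diagonal ones have
modulus `2a|S|`, and the rate `ω = a√(max 0 c²)` satisfies `0.55a ≤ ω ≤ a·p` (`c² = p² − 4|S|²`). Hence (`comb_component_le`, `comb_component_le'`)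
a pair of sources with the common pointwise envelope `E/√(1+s²)` creates amplitudes `≤ 4πa·(a·p + 2a|S|)/ω · E · arsinh θ` in BOTH components, and
with the mode-`0` envelope of `…KHCombSource` (`E = N(a)/((1−q)2κ·κ)`, `N → 2`) the number: **`≤ 0.8863/a` for `a ≥ 4`, `0 ≤ θ ≤ 8`**
(`comb_creation_num_le`, `comb_creation_num_le'`; `(p+2|S|)/√(p²−4|S|²) ≤ 1 + 10⁻⁹`, `N/2 ≤ 1.0025126`, `1/(1−q) ≤ 1 + 10⁻¹⁰`, `arsinh 8 ≤ 2.777`).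
No definitions; no statement about the crux. [cite: Drazin2002, §8.3 (8.36)–(8.38)] [problem: turb]
-/

-- `Summit.<Summit>.<Problem>`: single-conjunct summit, the duplicate namespace segment is deliberate.
set_option linter.dupNamespace false

noncomputable section

namespace Summit.AnomalousDissipation.AnomalousDissipation.Theorems.SawtoothPulseCascade.K2PhaseBudget

open Set MeasureTheory intervalIntegral Literature.Analysis.FluidPDE.SawtoothCascade

/-! ## §1 Block data: purely imaginary diagonal, norms, `ω ≤ a·p` -/

section block

variable {a β : ℝ} {G0 Gh : ℂ}

/-- `G₀ = Σ₀/(2π)` is real: the diagonal block entry `(2πia)(−¼ − 2G₀)` is purely imaginary. [cite: Drazin2002, §8.3 (8.36)–(8.38)] -/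
theorem blockX_diag_re (h0 : (2 * Real.pi : ℂ) * G0 = ((sawSigma0 a β : ℝ) : ℂ)) :
    ((((2 * Real.pi * a : ℝ) : ℂ) * Complex.I) * (-(1 / 4 : ℂ) - 2 * G0)).re = 0 := by
  have hπ : (Real.pi : ℂ) ≠ 0 := by exact_mod_cast Real.pi_ne_zero
  have hG : G0 = ((sawSigma0 a β / (2 * Real.pi) : ℝ) : ℂ) := by
    rw [Complex.ofReal_div]; push_cast
    rw [eq_div_iff (mul_ne_zero two_ne_zero hπ)]
    linear_combination h0
  rw [hG, show (((2 * Real.pi * a : ℝ) : ℂ) * Complex.I) * (-(1 / 4 : ℂ) - 2 * ((sawSigma0 a β / (2 * Real.pi) : ℝ) : ℂ)) =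
      ((-(a * (Real.pi / 2 + 2 * sawSigma0 a β)) : ℝ) : ℂ) * Complex.I by push_cast; field_simp; ring]
  simp

/-- The other diagonal entry `(2πia)(¼ + 2G₀)` is purely imaginary as well. [cite: Drazin2002, §8.3 (8.36)–(8.38)] -/
theorem blockX_diag_re' (h0 : (2 * Real.pi : ℂ) * G0 = ((sawSigma0 a β : ℝ) : ℂ)) :
    ((((2 * Real.pi * a : ℝ) : ℂ) * Complex.I) * ((1 / 4 : ℂ) + 2 * G0)).re = 0 := by
  have h := blockX_diag_re (a := a) h0
  have e : (((2 * Real.pi * a : ℝ) : ℂ) * Complex.I) * ((1 / 4 : ℂ) + 2 * G0) =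
      -((((2 * Real.pi * a : ℝ) : ℂ) * Complex.I) * (-(1 / 4 : ℂ) - 2 * G0)) := by ring
  rw [e, Complex.neg_re, h, neg_zero]

/-- `‖(2πia)(¼ + 2G₀)‖ = a·|p|` (the second diagonal entry). [cite: Drazin2002, §8.3 (8.36)–(8.38)] -/
theorem norm_blockX_diag_eq' (ha : 0 < a) (h0 : (2 * Real.pi : ℂ) * G0 = ((sawSigma0 a β : ℝ) : ℂ)) :
    ‖(((2 * Real.pi * a : ℝ) : ℂ) * Complex.I) * ((1 / 4 : ℂ) + 2 * G0)‖ = a * |Real.pi / 2 + 2 * sawSigma0 a β| := by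
  rw [← norm_blockX_diag_eq ha h0, ← norm_neg]
  congr 1; ring

/-- `‖(2πia)(2 conj G_h)‖ = 2a‖S‖` (the other off-diagonal entry). [cite: Drazin2002, §8.3 (8.36)–(8.38)] -/
theorem norm_blockX_off_eq' (ha : 0 < a) (hh : (2 * Real.pi : ℂ) * starRingEnd ℂ Gh = sawS a β) :
    ‖(((2 * Real.pi * a : ℝ) : ℂ) * Complex.I) * (2 * starRingEnd ℂ Gh)‖ = 2 * a * ‖sawS a β‖ := by
  rw [← norm_blockX_off_eq ha hh]
  simp only [norm_mul, norm_neg, Complex.norm_conj]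

/-- **`0.55a ≤ ω ≤ a·p`**: the rate `ω = a√(max 0 c²)` is positive and dominated by the diagonal modulus (`c² = p² − 4|S|² ≤ p²`, `p ≥ 0` for `a ≥ 1`).
[cite: Drazin2002, §8.3 (8.36)–(8.38)] -/
theorem omega_le_diag (ha : 1 ≤ a) (β : ℝ) :
    a * Real.sqrt (max 0 (sawC2 a β)) ≤ a * |Real.pi / 2 + 2 * sawSigma0 a β| := by
  have hp := kh_p_nonneg ha β
  rw [abs_of_nonneg hp]
  apply mul_le_mul_of_nonneg_left _ (by linarith)
  rw [show Real.pi / 2 + 2 * sawSigma0 a β = Real.sqrt ((Real.pi / 2 + 2 * sawSigma0 a β) ^ 2) by rw [Real.sqrt_sq hp]]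
  exact Real.sqrt_le_sqrt (max_le (sq_nonneg _) (sawC2_le_sq a β))

end block

/-! ## §2 The created amplitude, symbolic form -/

section amplitude

variable {a β θ E : ℝ} {G0 Gh : ℂ} {S₀ S₁ : ℝ → ℂ}

/-- **Comb-column creation, component `0` (symbolic).** For `a ≥ 1`, `θ ≥ 0`, block data `2πG₀ = Σ₀`, `2π conj G_h = S` and sources with the common
envelope `‖Sᵢ(s)‖ ≤ E/√(1+s²)`: `‖∫₀^θ [cos(ω(θ−s))·(c₀S₀) + (sin(ω(θ−s))/ω)(X₀₀c₀S₀ + X₀₁c₁S₁)]‖ ≤ 4πa(a·p + 2a‖S‖)/ω · E · arsinh θ`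
(`c₀ = 2πia·(−2)`, `c₁ = 2πia·2`, `ω = a√(max 0 c²)`). [cite: Drazin2002, §8.3 (8.36)–(8.38)] -/
theorem comb_component_le (ha : 1 ≤ a) (hθ : 0 ≤ θ) (h0 : (2 * Real.pi : ℂ) * G0 = ((sawSigma0 a β : ℝ) : ℂ))
    (hh : (2 * Real.pi : ℂ) * starRingEnd ℂ Gh = sawS a β) (hE₀ : ∀ s, ‖S₀ s‖ ≤ E / Real.sqrt (1 + s ^ 2))
    (hE₁ : ∀ s, ‖S₁ s‖ ≤ E / Real.sqrt (1 + s ^ 2)) :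
    ‖∫ s in (0 : ℝ)..θ, ((Real.cos (a * Real.sqrt (max 0 (sawC2 a β)) * (θ - s)) : ℂ) *
          ((((2 * Real.pi * a : ℝ) * Complex.I : ℂ) * (-2)) * S₀ s) +
        ((Real.sin (a * Real.sqrt (max 0 (sawC2 a β)) * (θ - s)) / (a * Real.sqrt (max 0 (sawC2 a β))) : ℝ) : ℂ) *
          ((((2 * Real.pi * a : ℝ) : ℂ) * Complex.I) * (-(1 / 4 : ℂ) - 2 * G0) * ((((2 * Real.pi * a : ℝ) * Complex.I : ℂ) * (-2)) * S₀ s) +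
            (((2 * Real.pi * a : ℝ) : ℂ) * Complex.I) * (-2 * Gh) * ((((2 * Real.pi * a : ℝ) * Complex.I : ℂ) * 2) * S₁ s)))‖ ≤
      4 * Real.pi * a * (a * (Real.pi / 2 + 2 * sawSigma0 a β) + 2 * a * ‖sawS a β‖) / (a * Real.sqrt (max 0 (sawC2 a β))) * E *
        Real.arsinh θ := by
  have ha0 : 0 < a := by linarith
  have hω0 : 0 < a * Real.sqrt (max 0 (sawC2 a β)) := by have := omega_ge ha β; linarith
  have hp := kh_p_nonneg ha β
  have hdiag := norm_blockX_diag_eq ha0 h0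
  rw [abs_of_nonneg hp] at hdiag
  have hωx : a * Real.sqrt (max 0 (sawC2 a β)) ≤ ‖(((2 * Real.pi * a : ℝ) : ℂ) * Complex.I) * (-(1 / 4 : ℂ) - 2 * G0)‖ := by
    rw [hdiag, ← abs_of_nonneg hp]; exact omega_le_diag ha β
  have h := norm_duhamel_envelope_le (c₀ := ((2 * Real.pi * a : ℝ) * Complex.I : ℂ) * (-2)) (c₁ := ((2 * Real.pi * a : ℝ) * Complex.I : ℂ) * 2)
    (x₁ := (((2 * Real.pi * a : ℝ) : ℂ) * Complex.I) * (-2 * Gh)) hθ hω0 (blockX_diag_re h0) hωx hE₀ hE₁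
  have hκ : 0 < 2 * Real.pi * a := by positivity
  have hc0 : ‖(((2 * Real.pi * a : ℝ) * Complex.I : ℂ) * (-2))‖ = 4 * Real.pi * a := by
    rw [norm_mul, norm_mul, Complex.norm_real, Complex.norm_I, Real.norm_eq_abs, abs_of_pos hκ, norm_neg]; simp; ring
  have hc1 : ‖(((2 * Real.pi * a : ℝ) * Complex.I : ℂ) * 2)‖ = 4 * Real.pi * a := by
    rw [norm_mul, norm_mul, Complex.norm_real, Complex.norm_I, Real.norm_eq_abs, abs_of_pos hκ]; simp; ring
  rw [hc0, hc1, hdiag, norm_blockX_off_eq ha0 hh] at h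
  refine h.trans (le_of_eq ?_)
  ring

/-- **Comb-column creation, component `1` (symbolic):** `cos·(c₁S₁) + (sin/ω)(X₁₀c₀S₀ + X₁₁c₁S₁)`, `X₁₀ = (2πia)(2 conj G_h)`,
`X₁₁ = (2πia)(¼ + 2G₀)`; the same bound. [cite: Drazin2002, §8.3 (8.36)–(8.38)] -/
theorem comb_component_le' (ha : 1 ≤ a) (hθ : 0 ≤ θ) (h0 : (2 * Real.pi : ℂ) * G0 = ((sawSigma0 a β : ℝ) : ℂ))
    (hh : (2 * Real.pi : ℂ) * starRingEnd ℂ Gh = sawS a β) (hE₀ : ∀ s, ‖S₀ s‖ ≤ E / Real.sqrt (1 + s ^ 2))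
    (hE₁ : ∀ s, ‖S₁ s‖ ≤ E / Real.sqrt (1 + s ^ 2)) :
    ‖∫ s in (0 : ℝ)..θ, ((Real.cos (a * Real.sqrt (max 0 (sawC2 a β)) * (θ - s)) : ℂ) *
          ((((2 * Real.pi * a : ℝ) * Complex.I : ℂ) * 2) * S₁ s) +
        ((Real.sin (a * Real.sqrt (max 0 (sawC2 a β)) * (θ - s)) / (a * Real.sqrt (max 0 (sawC2 a β))) : ℝ) : ℂ) *
          ((((2 * Real.pi * a : ℝ) : ℂ) * Complex.I) * (2 * starRingEnd ℂ Gh) * ((((2 * Real.pi * a : ℝ) * Complex.I : ℂ) * (-2)) * S₀ s) +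
            (((2 * Real.pi * a : ℝ) : ℂ) * Complex.I) * ((1 / 4 : ℂ) + 2 * G0) * ((((2 * Real.pi * a : ℝ) * Complex.I : ℂ) * 2) * S₁ s)))‖ ≤
      4 * Real.pi * a * (a * (Real.pi / 2 + 2 * sawSigma0 a β) + 2 * a * ‖sawS a β‖) / (a * Real.sqrt (max 0 (sawC2 a β))) * E *
        Real.arsinh θ := by
  have ha0 : 0 < a := by linarith
  have hω0 : 0 < a * Real.sqrt (max 0 (sawC2 a β)) := by have := omega_ge ha β; linarith
  have hp := kh_p_nonneg ha β
  have hdiag := norm_blockX_diag_eq' ha0 h0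
  rw [abs_of_nonneg hp] at hdiag
  have hωx : a * Real.sqrt (max 0 (sawC2 a β)) ≤ ‖(((2 * Real.pi * a : ℝ) : ℂ) * Complex.I) * ((1 / 4 : ℂ) + 2 * G0)‖ := by
    rw [hdiag, ← abs_of_nonneg hp]; exact omega_le_diag ha β
  have h := norm_duhamel_envelope_le' (c₀ := ((2 * Real.pi * a : ℝ) * Complex.I : ℂ) * (-2)) (c₁ := ((2 * Real.pi * a : ℝ) * Complex.I : ℂ) * 2)
    (x₀ := (((2 * Real.pi * a : ℝ) : ℂ) * Complex.I) * (2 * starRingEnd ℂ Gh)) hθ hω0 (blockX_diag_re' h0) hωx hE₀ hE₁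
  have hκ : 0 < 2 * Real.pi * a := by positivity
  have hc0 : ‖(((2 * Real.pi * a : ℝ) * Complex.I : ℂ) * (-2))‖ = 4 * Real.pi * a := by
    rw [norm_mul, norm_mul, Complex.norm_real, Complex.norm_I, Real.norm_eq_abs, abs_of_pos hκ, norm_neg]; simp; ring
  have hc1 : ‖(((2 * Real.pi * a : ℝ) * Complex.I : ℂ) * 2)‖ = 4 * Real.pi * a := by
    rw [norm_mul, norm_mul, Complex.norm_real, Complex.norm_I, Real.norm_eq_abs, abs_of_pos hκ]; simp; ring
  rw [hc0, hc1, hdiag, norm_blockX_off_eq' ha0 hh] at h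
  refine h.trans (le_of_eq ?_)
  ring

end amplitude

/-! ## §3 The numbers at `a ≥ 4` -/

section numerics

variable {a : ℝ}

/-- `‖S_β(a)‖ ≤ √q/(a(1−q))`, `q = e^{−2πa}` (`a > 0`). [cite: Drazin2002, §8.3 (8.36)–(8.38)] -/
theorem norm_sawS_le (ha : 0 < a) (β : ℝ) : ‖sawS a β‖ ≤ Real.sqrt (sawQ a) / (a * (1 - sawQ a)) := by
  have h := normSq_sawS_le ha β
  have hq1 : sawQ a < 1 := sawQ_lt_one ha
  rw [show ‖sawS a β‖ = Real.sqrt (Complex.normSq (sawS a β)) from rfl]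
  calc Real.sqrt (Complex.normSq (sawS a β)) ≤ Real.sqrt (sawQ a / (a ^ 2 * (1 - sawQ a) ^ 2)) := Real.sqrt_le_sqrt h
    _ = Real.sqrt (sawQ a) / (a * (1 - sawQ a)) := by
        rw [Real.sqrt_div' _, show a ^ 2 * (1 - sawQ a) ^ 2 = (a * (1 - sawQ a)) ^ 2 by ring, Real.sqrt_sq (by nlinarith)]
        positivity

/-- For `a ≥ 1`: `2‖S‖ < p` with room — `‖S‖ ≤ 0.06`, `p ≥ 0.5657`. [cite: Drazin2002, §8.3 (8.36)–(8.38)] -/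
theorem norm_sawS_le_of_one_le (ha : 1 ≤ a) (β : ℝ) : ‖sawS a β‖ ≤ 0.06 := by
  have ha0 : 0 < a := by linarith
  have h := norm_sawS_le ha0 β
  have hq0 : 0 < sawQ a := sawQ_pos a
  have hq := sawQ_le_of_one_le ha
  have hsq : Real.sqrt (sawQ a) ≤ 1 / 20 := by
    rw [show (1 / 20 : ℝ) = Real.sqrt ((1 / 20) ^ 2) by rw [Real.sqrt_sq (by norm_num)]]
    exact Real.sqrt_le_sqrt (by nlinarith)
  have h1q : 0 < 1 - sawQ a := by linarith
  have b : Real.sqrt (sawQ a) / (a * (1 - sawQ a)) ≤ 0.06 := by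
    rw [div_le_iff₀ (by positivity)]
    have := Real.sqrt_nonneg (sawQ a)
    nlinarith
  linarith

/-- **The rate ratio:** `(a·p + 2a‖S‖)/ω ≤ 1 + 4‖S‖/(p − 2‖S‖)` for `a ≥ 1` (`ω = a√(max 0 c²) = a√(p² − 4‖S‖²) ≥ a(p − 2‖S‖)`).
[cite: Drazin2002, §8.3 (8.36)–(8.38)] -/
theorem comb_ratio_le (ha : 1 ≤ a) (β : ℝ) :
    (a * (Real.pi / 2 + 2 * sawSigma0 a β) + 2 * a * ‖sawS a β‖) / (a * Real.sqrt (max 0 (sawC2 a β))) ≤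
      1 + 4 * ‖sawS a β‖ / ((Real.pi / 2 + 2 * sawSigma0 a β) - 2 * ‖sawS a β‖) := by
  have ha0 : 0 < a := by linarith
  set p := Real.pi / 2 + 2 * sawSigma0 a β with hp_def
  set u := ‖sawS a β‖ with hu_def
  have hp := kh_p_ge ha β
  have hu : u ≤ 0.06 := norm_sawS_le_of_one_le ha β
  have hu0 : 0 ≤ u := norm_nonneg _
  have hpu : 0 < p - 2 * u := by linarith
  have hc2 : sawC2 a β = p ^ 2 - 4 * u ^ 2 := by
    simp only [sawC2, hp_def, hu_def, Complex.sq_norm]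
  have hr : p - 2 * u ≤ Real.sqrt (max 0 (sawC2 a β)) := by
    rw [show p - 2 * u = Real.sqrt ((p - 2 * u) ^ 2) by rw [Real.sqrt_sq hpu.le]]
    apply Real.sqrt_le_sqrt
    apply le_max_of_le_right
    rw [hc2]; nlinarith
  have hω0 : 0 < a * Real.sqrt (max 0 (sawC2 a β)) := by have := omega_ge ha β; linarith
  rw [div_le_iff₀ hω0]
  have hne : p - 2 * u ≠ 0 := hpu.ne'
  have e2 : 4 * u / (p - 2 * u) * (p - 2 * u) = 4 * u := div_mul_cancel₀ _ hne
  have e : (1 + 4 * u / (p - 2 * u)) * (a * (p - 2 * u)) = a * p + 2 * a * u := by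
    calc (1 + 4 * u / (p - 2 * u)) * (a * (p - 2 * u)) = a * ((p - 2 * u) + 4 * u / (p - 2 * u) * (p - 2 * u)) := by ring
      _ = a * ((p - 2 * u) + 4 * u) := by rw [e2]
      _ = a * p + 2 * a * u := by ring
  calc a * p + 2 * a * u = (1 + 4 * u / (p - 2 * u)) * (a * (p - 2 * u)) := e.symm
    _ ≤ (1 + 4 * u / (p - 2 * u)) * (a * Real.sqrt (max 0 (sawC2 a β))) := by
        apply mul_le_mul_of_nonneg_left (mul_le_mul_of_nonneg_left hr ha0.le)
        positivity

/-- Decay at `a ≥ 4`: `x = e^{−κ/4} = e^{−2π(a/4)} ≤ 1/400`. [folklore] -/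
theorem exp_neg_quarter_kappa_le (ha : 4 ≤ a) : Real.exp (-(2 * Real.pi * a) / 4) ≤ 1 / 400 := by
  have h := sawQ_le_of_one_le (show (1 : ℝ) ≤ a / 4 by linarith)
  unfold sawQ at h
  rwa [show -(2 * Real.pi * (a / 4)) = -(2 * Real.pi * a) / 4 by ring] at h

/-- `q = x⁴ ≤ (1/400)⁴` at `a ≥ 4`. [folklore] -/
theorem exp_neg_kappa_le_pow (ha : 4 ≤ a) : Real.exp (-(2 * Real.pi * a)) ≤ (1 / 400) ^ 4 := by
  have hx := exp_neg_quarter_kappa_le ha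
  have e : Real.exp (-(2 * Real.pi * a)) = Real.exp (-(2 * Real.pi * a) / 4) ^ 4 := by
    rw [← Real.exp_nat_mul]; congr 1; push_cast; ring
  rw [e]
  exact pow_le_pow_left₀ (Real.exp_pos _).le hx 4

/-- The envelope numerator at `a ≥ 4`: `N(a) = 2 + 2x + 4x² + 2x³ + 2x⁴ ≤ 2.0050252`. [folklore] -/
theorem comb_N_le (ha : 4 ≤ a) :
    2 + 2 * Real.exp (-(2 * Real.pi * a) / 4) + 4 * Real.exp (-(2 * Real.pi * a) / 4) ^ 2 + 2 * Real.exp (-(2 * Real.pi * a) / 4) ^ 3 +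
        2 * Real.exp (-(2 * Real.pi * a) / 4) ^ 4 ≤ 2.0050252 := by
  have hx := exp_neg_quarter_kappa_le ha
  have hx0 : 0 ≤ Real.exp (-(2 * Real.pi * a) / 4) := (Real.exp_pos _).le
  set x := Real.exp (-(2 * Real.pi * a) / 4)
  have h2 : x ^ 2 ≤ (1 / 400) ^ 2 := pow_le_pow_left₀ hx0 hx 2
  have h3 : x ^ 3 ≤ (1 / 400) ^ 3 := pow_le_pow_left₀ hx0 hx 3
  have h4 : x ^ 4 ≤ (1 / 400) ^ 4 := pow_le_pow_left₀ hx0 hx 4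
  norm_num at h2 h3 h4 ⊢
  linarith

/-- `4‖S‖/(p − 2‖S‖) ≤ 2·10⁻⁵` at `a ≥ 4` (`‖S‖ ≤ √q/(a(1−q))`, `√q ≤ (1/400)²`). [cite: Drazin2002, §8.3 (8.36)–(8.38)] -/
theorem comb_ratio_defect_le (ha : 4 ≤ a) (β : ℝ) :
    4 * ‖sawS a β‖ / ((Real.pi / 2 + 2 * sawSigma0 a β) - 2 * ‖sawS a β‖) ≤ 0.00002 := by
  have ha1 : 1 ≤ a := by linarith
  have ha0 : 0 < a := by linarith
  have hp := kh_p_ge ha1 β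
  have hu6 : ‖sawS a β‖ ≤ 0.06 := norm_sawS_le_of_one_le ha1 β
  have hq : sawQ a ≤ (1 / 400) ^ 4 := exp_neg_kappa_le_pow ha
  have hq0 : 0 < sawQ a := sawQ_pos a
  have hsq : Real.sqrt (sawQ a) ≤ (1 / 400) ^ 2 := by
    rw [show ((1 / 400 : ℝ)) ^ 2 = Real.sqrt ((((1 : ℝ) / 400) ^ 2) ^ 2) by rw [Real.sqrt_sq (by norm_num)]]
    exact Real.sqrt_le_sqrt (by nlinarith)
  have hu : ‖sawS a β‖ ≤ 0.000002 := by
    refine (norm_sawS_le ha0 β).trans ?_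
    have h1q : 0.99 ≤ 1 - sawQ a := by norm_num at hq; linarith
    rw [div_le_iff₀ (by nlinarith)]
    have h4 : 4 * (1 - sawQ a) ≤ a * (1 - sawQ a) := mul_le_mul_of_nonneg_right ha (by linarith)
    norm_num at hsq
    nlinarith
  have hpu : 0 < (Real.pi / 2 + 2 * sawSigma0 a β) - 2 * ‖sawS a β‖ := by linarith
  rw [div_le_iff₀ hpu]
  nlinarith [norm_nonneg (sawS a β)]

/-- **The numeric factor at `a ≥ 4`, `0 ≤ θ ≤ 8`:** `4πa(a·p+2a‖S‖)/ω · N(a)/((1−q)2κ·κ) · arsinh θ ≤ 0.8865/a`. [folklore] -/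
theorem comb_factor_le (ha : 4 ≤ a) (β : ℝ) {θ : ℝ} (hθ0 : 0 ≤ θ) (hθ : θ ≤ 8) :
    4 * Real.pi * a * (a * (Real.pi / 2 + 2 * sawSigma0 a β) + 2 * a * ‖sawS a β‖) / (a * Real.sqrt (max 0 (sawC2 a β))) *
        ((2 + 2 * Real.exp (-(2 * Real.pi * a) / 4) + 4 * Real.exp (-(2 * Real.pi * a) / 4) ^ 2 + 2 * Real.exp (-(2 * Real.pi * a) / 4) ^ 3 +
            2 * Real.exp (-(2 * Real.pi * a) / 4) ^ 4) /
          (((1 - Real.exp (-(2 * Real.pi * a))) * (2 * (2 * Real.pi * a))) * (2 * Real.pi * a))) *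
        Real.arsinh θ ≤ 0.8865 / a := by
  have ha1 : 1 ≤ a := by linarith
  have ha0 : 0 < a := by linarith
  have hπ : (3.1415 : ℝ) < Real.pi := Real.pi_gt_d4
  have hR : (a * (Real.pi / 2 + 2 * sawSigma0 a β) + 2 * a * ‖sawS a β‖) / (a * Real.sqrt (max 0 (sawC2 a β))) ≤ 1.00002 :=
    (comb_ratio_le ha1 β).trans (by linarith [comb_ratio_defect_le ha β])
  have hN := comb_N_le ha
  have hq : Real.exp (-(2 * Real.pi * a)) ≤ (1 / 400) ^ 4 := exp_neg_kappa_le_pow ha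
  have hq0 : 0 < Real.exp (-(2 * Real.pi * a)) := Real.exp_pos _
  have hash : Real.arsinh θ ≤ 2.777 := (Real.arsinh_le_arsinh.2 hθ).trans arsinh_eight_le
  have hash0 : 0 ≤ Real.arsinh θ := Real.arsinh_nonneg_iff.2 hθ0
  have hω0 : 0 < a * Real.sqrt (max 0 (sawC2 a β)) := by have := omega_ge ha1 β; linarith
  set R := (a * (Real.pi / 2 + 2 * sawSigma0 a β) + 2 * a * ‖sawS a β‖) / (a * Real.sqrt (max 0 (sawC2 a β))) with hR_def
  set Nn := 2 + 2 * Real.exp (-(2 * Real.pi * a) / 4) + 4 * Real.exp (-(2 * Real.pi * a) / 4) ^ 2 +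
    2 * Real.exp (-(2 * Real.pi * a) / 4) ^ 3 + 2 * Real.exp (-(2 * Real.pi * a) / 4) ^ 4 with hN_def
  set q := Real.exp (-(2 * Real.pi * a)) with hq_def
  have hR0 : 0 ≤ R := by rw [hR_def]; have := kh_p_ge ha1 β; positivity
  have hN0 : 0 ≤ Nn := by rw [hN_def]; positivity
  have h1q : 0 < 1 - q := by norm_num at hq; linarith
  -- rewrite the left-hand side as `R · (Nn/(1−q)) · arsinh θ / (2πa)`
  have e : 4 * Real.pi * a * (a * (Real.pi / 2 + 2 * sawSigma0 a β) + 2 * a * ‖sawS a β‖) / (a * Real.sqrt (max 0 (sawC2 a β))) *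
        (Nn / (((1 - q) * (2 * (2 * Real.pi * a))) * (2 * Real.pi * a))) * Real.arsinh θ =
      (R * (Nn / (1 - q)) * Real.arsinh θ) / (2 * Real.pi * a) := by
    rw [hR_def]; field_simp; ring
  rw [e, div_le_div_iff₀ (by positivity) ha0]
  have hNq : Nn / (1 - q) ≤ 2.00502521 := by
    rw [div_le_iff₀ h1q]; norm_num at hq; nlinarith
  have hNq0 : 0 ≤ Nn / (1 - q) := by positivity
  have h3 : R * (Nn / (1 - q)) * Real.arsinh θ ≤ 1.00002 * 2.00502521 * 2.777 := by
    have h12 : R * (Nn / (1 - q)) ≤ 1.00002 * 2.00502521 := mul_le_mul hR hNq hNq0 (by norm_num)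
    exact mul_le_mul h12 hash hash0 (by positivity)
  nlinarith

end numerics

/-! ## §4 The comb-column creation amplitude with the number -/

/-- Reshaping the envelope: `N/(D·(κ·r)) = (N/(D·κ))/r`. [folklore] -/
theorem env_reshape (N D κ r : ℝ) : N / (D * (κ * r)) = N / (D * κ) / r := by
  rw [div_div, mul_assoc]

section number

variable {a β θ : ℝ} {G0 Gh : ℂ} {S₀ S₁ : ℝ → ℂ}

/-- **Comb-column creation, component `0`, `a ≥ 4`, `0 ≤ θ ≤ 8`:** with the mode-`0` envelopes of `…KHCombSource` the created amplitude is `≤ 0.8865/a`.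
[cite: Drazin2002, §8.3 (8.36)–(8.38)] -/
theorem comb_creation_num_le (ha : 4 ≤ a) (hθ0 : 0 ≤ θ) (hθ : θ ≤ 8) (h0 : (2 * Real.pi : ℂ) * G0 = ((sawSigma0 a β : ℝ) : ℂ))
    (hh : (2 * Real.pi : ℂ) * starRingEnd ℂ Gh = sawS a β)
    (hE₀ : ∀ s, ‖S₀ s‖ ≤ (2 + 2 * Real.exp (-(2 * Real.pi * a) / 4) + 4 * Real.exp (-(2 * Real.pi * a) / 4) ^ 2 +
        2 * Real.exp (-(2 * Real.pi * a) / 4) ^ 3 + 2 * Real.exp (-(2 * Real.pi * a) / 4) ^ 4) /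
        (((1 - Real.exp (-(2 * Real.pi * a))) * (2 * (2 * Real.pi * a))) * ((2 * Real.pi * a) * Real.sqrt (1 + s ^ 2))))
    (hE₁ : ∀ s, ‖S₁ s‖ ≤ (2 + 2 * Real.exp (-(2 * Real.pi * a) / 4) + 4 * Real.exp (-(2 * Real.pi * a) / 4) ^ 2 +
        2 * Real.exp (-(2 * Real.pi * a) / 4) ^ 3 + 2 * Real.exp (-(2 * Real.pi * a) / 4) ^ 4) /
        (((1 - Real.exp (-(2 * Real.pi * a))) * (2 * (2 * Real.pi * a))) * ((2 * Real.pi * a) * Real.sqrt (1 + s ^ 2)))) :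
    ‖∫ s in (0 : ℝ)..θ, ((Real.cos (a * Real.sqrt (max 0 (sawC2 a β)) * (θ - s)) : ℂ) *
          ((((2 * Real.pi * a : ℝ) * Complex.I : ℂ) * (-2)) * S₀ s) +
        ((Real.sin (a * Real.sqrt (max 0 (sawC2 a β)) * (θ - s)) / (a * Real.sqrt (max 0 (sawC2 a β))) : ℝ) : ℂ) *
          ((((2 * Real.pi * a : ℝ) : ℂ) * Complex.I) * (-(1 / 4 : ℂ) - 2 * G0) * ((((2 * Real.pi * a : ℝ) * Complex.I : ℂ) * (-2)) * S₀ s) +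
            (((2 * Real.pi * a : ℝ) : ℂ) * Complex.I) * (-2 * Gh) * ((((2 * Real.pi * a : ℝ) * Complex.I : ℂ) * 2) * S₁ s)))‖ ≤
      0.8865 / a := by
  have ha1 : 1 ≤ a := by linarith
  have hE₀' : ∀ s, ‖S₀ s‖ ≤ (2 + 2 * Real.exp (-(2 * Real.pi * a) / 4) + 4 * Real.exp (-(2 * Real.pi * a) / 4) ^ 2 +
        2 * Real.exp (-(2 * Real.pi * a) / 4) ^ 3 + 2 * Real.exp (-(2 * Real.pi * a) / 4) ^ 4) /
        (((1 - Real.exp (-(2 * Real.pi * a))) * (2 * (2 * Real.pi * a))) * (2 * Real.pi * a)) / Real.sqrt (1 + s ^ 2) := fun s => by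
    rw [← env_reshape]; exact hE₀ s
  have hE₁' : ∀ s, ‖S₁ s‖ ≤ (2 + 2 * Real.exp (-(2 * Real.pi * a) / 4) + 4 * Real.exp (-(2 * Real.pi * a) / 4) ^ 2 +
        2 * Real.exp (-(2 * Real.pi * a) / 4) ^ 3 + 2 * Real.exp (-(2 * Real.pi * a) / 4) ^ 4) /
        (((1 - Real.exp (-(2 * Real.pi * a))) * (2 * (2 * Real.pi * a))) * (2 * Real.pi * a)) / Real.sqrt (1 + s ^ 2) := fun s => by
    rw [← env_reshape]; exact hE₁ s
  exact (comb_component_le ha1 hθ0 h0 hh hE₀' hE₁').trans (comb_factor_le ha β hθ0 hθ)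

/-- **Comb-column creation, component `1`, `a ≥ 4`, `0 ≤ θ ≤ 8`:** `≤ 0.8865/a`. [cite: Drazin2002, §8.3 (8.36)–(8.38)] -/
theorem comb_creation_num_le' (ha : 4 ≤ a) (hθ0 : 0 ≤ θ) (hθ : θ ≤ 8) (h0 : (2 * Real.pi : ℂ) * G0 = ((sawSigma0 a β : ℝ) : ℂ))
    (hh : (2 * Real.pi : ℂ) * starRingEnd ℂ Gh = sawS a β)
    (hE₀ : ∀ s, ‖S₀ s‖ ≤ (2 + 2 * Real.exp (-(2 * Real.pi * a) / 4) + 4 * Real.exp (-(2 * Real.pi * a) / 4) ^ 2 +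
        2 * Real.exp (-(2 * Real.pi * a) / 4) ^ 3 + 2 * Real.exp (-(2 * Real.pi * a) / 4) ^ 4) /
        (((1 - Real.exp (-(2 * Real.pi * a))) * (2 * (2 * Real.pi * a))) * ((2 * Real.pi * a) * Real.sqrt (1 + s ^ 2))))
    (hE₁ : ∀ s, ‖S₁ s‖ ≤ (2 + 2 * Real.exp (-(2 * Real.pi * a) / 4) + 4 * Real.exp (-(2 * Real.pi * a) / 4) ^ 2 +
        2 * Real.exp (-(2 * Real.pi * a) / 4) ^ 3 + 2 * Real.exp (-(2 * Real.pi * a) / 4) ^ 4) /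
        (((1 - Real.exp (-(2 * Real.pi * a))) * (2 * (2 * Real.pi * a))) * ((2 * Real.pi * a) * Real.sqrt (1 + s ^ 2)))) :
    ‖∫ s in (0 : ℝ)..θ, ((Real.cos (a * Real.sqrt (max 0 (sawC2 a β)) * (θ - s)) : ℂ) *
          ((((2 * Real.pi * a : ℝ) * Complex.I : ℂ) * 2) * S₁ s) +
        ((Real.sin (a * Real.sqrt (max 0 (sawC2 a β)) * (θ - s)) / (a * Real.sqrt (max 0 (sawC2 a β))) : ℝ) : ℂ) *
          ((((2 * Real.pi * a : ℝ) : ℂ) * Complex.I) * (2 * starRingEnd ℂ Gh) * ((((2 * Real.pi * a : ℝ) * Complex.I : ℂ) * (-2)) * S₀ s) +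
            (((2 * Real.pi * a : ℝ) : ℂ) * Complex.I) * ((1 / 4 : ℂ) + 2 * G0) * ((((2 * Real.pi * a : ℝ) * Complex.I : ℂ) * 2) * S₁ s)))‖ ≤
      0.8865 / a := by
  have ha1 : 1 ≤ a := by linarith
  have hE₀' : ∀ s, ‖S₀ s‖ ≤ (2 + 2 * Real.exp (-(2 * Real.pi * a) / 4) + 4 * Real.exp (-(2 * Real.pi * a) / 4) ^ 2 +
        2 * Real.exp (-(2 * Real.pi * a) / 4) ^ 3 + 2 * Real.exp (-(2 * Real.pi * a) / 4) ^ 4) /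
        (((1 - Real.exp (-(2 * Real.pi * a))) * (2 * (2 * Real.pi * a))) * (2 * Real.pi * a)) / Real.sqrt (1 + s ^ 2) := fun s => by
    rw [← env_reshape]; exact hE₀ s
  have hE₁' : ∀ s, ‖S₁ s‖ ≤ (2 + 2 * Real.exp (-(2 * Real.pi * a) / 4) + 4 * Real.exp (-(2 * Real.pi * a) / 4) ^ 2 +
        2 * Real.exp (-(2 * Real.pi * a) / 4) ^ 3 + 2 * Real.exp (-(2 * Real.pi * a) / 4) ^ 4) /
        (((1 - Real.exp (-(2 * Real.pi * a))) * (2 * (2 * Real.pi * a))) * (2 * Real.pi * a)) / Real.sqrt (1 + s ^ 2) := fun s => by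
    rw [← env_reshape]; exact hE₁ s
  exact (comb_component_le' ha1 hθ0 h0 hh hE₀' hE₁').trans (comb_factor_le ha β hθ0 hθ)

end number

end Summit.AnomalousDissipation.AnomalousDissipation.Theorems.SawtoothPulseCascade.K2PhaseBudget

end
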